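import Mathlib
import HarnessLib
import Summits.CriticalPhenomena.SAWScalingLimit.Theorems.SAWSpinMonotoneQCIdentificationDefs
import Summits.CriticalPhenomena.SAWScalingLimit.Theorems.SAWSpinMonotoneQCIdentificationAffineDictionary

/-!
# Regrouping face corners by lattice site (helper, line `eight_fifths_primitive`)

Helper sub-goal (wave 3) of the S7 assembly of `stub_noBranching : NoFoldBound → NoBranching` (and of
`stub_rayCondition`) of line `eight_fifths_primitive`, crux `QCIdentification`
(stmt-CriticalPhenomena-16772); namespace of the checked skeleton, sub-namespace `Stokes`; vocabulary
from `…AffineDictionary` (`Dev.triVert v k`, `k : Fin 3`, the counterclockwise corners of the triangle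
`Δ_v` of `𝕋` dual to the hexagonal-lattice vertex `v`) and the barrier file
`ParafermionicHalfCauchyRiemann` (`HexKernel.face s j`, `j : Fin 6`, the six faces of `𝕋` around the
site `s`, counterclockwise; `HexKernel.face_inj`).

**What.** The combinatorial Gauss–Bonnet count proving `NoBranching` sums corner data
`f v k` (corner angles of the image triangles) face by face, `Σ_{v ∈ Λ} Σ_{k : Fin 3} f v k`, and must
regroup it site by site. The corner `k` of the face `v` sits at the site `triVert v k`; conversely the
site `s` is the corner `siteCornerIdx j` of its `j`-th face `face s j`, with the explicit table
`siteCornerIdx = ![2, 1, 0, 2, 1, 0]` (`triVert_face`), and `v` is the face number `cornerFaceIdx v k`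
(`= ![2, 4, 0] k` on up faces, `![5, 1, 3] k` on down faces) of the hexagon around its `k`-th corner
(`face_triVert`); the two tables are mutually inverse (`siteCornerIdx_cornerFaceIdx`,
`cornerFaceIdx_face`), so `(v, k) ↦ (triVert v k, cornerFaceIdx v k)` is a bijection from corners to
(site, face-number) pairs with inverse `(s, j) ↦ (face s j, siteCornerIdx j)` (registered
`st_face_of_triVert`: `triVert v k = s → ∃! j, face s j = v ∧ siteCornerIdx j = k`). Consequently
(registered `st_sum_corners_by_site`), with `cornerSites Λ` the image of the corners of `Λ`
(`s ∈ cornerSites Λ ↔ ∃ j, face s j ∈ Λ`, `mem_cornerSites_iff`):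

  `Σ_{v ∈ Λ} Σ_k f v k = Σ_{s ∈ cornerSites Λ} Σ_{j : Fin 6} [face s j ∈ Λ] f (face s j) (siteCornerIdx j)`,

and (registered `st_sum_corners_split`) the right side splits into the interior sites (all six faces in
`Λ`, no indicator) and the boundary sites (some face missing). (Usage note: the corner angle
`NB.cornerAngle F v k`, between the darts `k` and `k + 1`, is the angle of the image triangle at the
corner `triVert v (k + 1)`; to regroup corner angles by site take `f v k := NB.cornerAngle F v (k + 2)`.)

Sources: folklore (regrouping a sum along a bijection / by fibres); the stub report
`STUB-REPORT-noBranching.md` of this line (§2, S4/S7: corners grouped by site, interior fans vs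
boundary arcs).
-/

open scoped BigOperators
open Literature.Probability.LatticeModels Literature.Probability.RandomPlanarGeometry
open Literature.Probability.RandomPlanarGeometry.SAW
open Literature.Barriers.CriticalPhenomena

namespace Summit.CriticalPhenomena.SAWScalingLimit.Cruxes.QCIdentification.EightFifthsPrimitive

namespace Stokes

/-! ## The two index tables -/

/-- The corner number of the site `s` in its `j`-th face: `triVert (face s j) (siteCornerIdx j) = s`.
Explicitly `![2, 1, 0, 2, 1, 0]` (independent of `s`). -/
def siteCornerIdx : Fin 6 → Fin 3 := ![2, 1, 0, 2, 1, 0]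

/-- The face number of `v` in the hexagon around its `k`-th corner:
`face (triVert v k) (cornerFaceIdx v k) = v`. Up faces: `![2, 4, 0]`; down faces: `![5, 1, 3]`. -/
def cornerFaceIdx (v : HexVertex) (k : Fin 3) : Fin 6 :=
  if v.2 = 0 then ![2, 4, 0] k else ![5, 1, 3] k

/-- The site `s` is the corner `siteCornerIdx j` of its `j`-th face. -/
theorem triVert_face (s : Site 2) (j : Fin 6) :
    Dev.triVert (HexKernel.face s j) (siteCornerIdx j) = s := by
  fin_cases j <;>
    simp [Dev.triVert, HexKernel.face, siteCornerIdx, funext_iff, Fin.forall_fin_two, Pi.single_apply]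

/-- The face `v` is the face number `cornerFaceIdx v k` of the hexagon around its `k`-th corner. -/
theorem face_triVert (v : HexVertex) (k : Fin 3) :
    HexKernel.face (Dev.triVert v k) (cornerFaceIdx v k) = v := by
  obtain ⟨x, t⟩ := v
  fin_cases t <;> fin_cases k <;>
    simp [Dev.triVert, HexKernel.face, cornerFaceIdx, Prod.ext_iff, funext_iff, Fin.forall_fin_two,
      Pi.single_apply]

/-- The two tables are inverse to each other (corner side). -/
theorem siteCornerIdx_cornerFaceIdx (v : HexVertex) (k : Fin 3) :
    siteCornerIdx (cornerFaceIdx v k) = k := by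
  obtain ⟨x, t⟩ := v
  fin_cases t <;> fin_cases k <;> simp [siteCornerIdx, cornerFaceIdx]

/-- The two tables are inverse to each other (site side). -/
theorem cornerFaceIdx_face (s : Site 2) (j : Fin 6) :
    cornerFaceIdx (HexKernel.face s j) (siteCornerIdx j) = j := by
  fin_cases j <;> simp [HexKernel.face, siteCornerIdx, cornerFaceIdx]

/-- **The faces at a corner (registered form).** If the site `s` is the `k`-th corner of the face `v`,
then `v` is exactly one of the six faces around `s` with matching corner number. -/
theorem st_face_of_triVert : ∀ {v : HexVertex} {k : Fin 3} {s : Site 2}, Dev.triVert v k = s → ∃! j : Fin 6, HexKernel.face s j = v ∧ siteCornerIdx j = k := by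
  intro v k s h
  subst h
  refine ⟨cornerFaceIdx v k, ⟨face_triVert v k, siteCornerIdx_cornerFaceIdx v k⟩, ?_⟩
  rintro j ⟨hj, -⟩
  rw [← HexKernel.face_inj (Dev.triVert v k), hj, face_triVert]

/-- The face number of `v` around its `k`-th corner is determined by `v`:
`face (triVert v k) j = v → j = cornerFaceIdx v k`. -/
theorem eq_cornerFaceIdx_of_face_eq {v : HexVertex} {k : Fin 3} {j : Fin 6}
    (h : HexKernel.face (Dev.triVert v k) j = v) : j = cornerFaceIdx v k := by
  rw [← HexKernel.face_inj (Dev.triVert v k), h, face_triVert]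

/-- The three corners of a face are distinct sites. -/
theorem triVert_injective (v : HexVertex) : Function.Injective (Dev.triVert v) := by
  intro k k' h
  have h1 : HexKernel.face (Dev.triVert v k) (cornerFaceIdx v k') = v := by
    rw [h]
    exact face_triVert v k'
  have h2 := congrArg siteCornerIdx (eq_cornerFaceIdx_of_face_eq h1)
  rw [siteCornerIdx_cornerFaceIdx, siteCornerIdx_cornerFaceIdx] at h2
  exact h2.symm

/-! ## Corner sites -/

/-- The corner sites of `Λ`: all vertices of the triangles `Δ_v`, `v ∈ Λ` (the image of the corners
`(v, k)`, `v ∈ Λ`, `k : Fin 3`, under `(v, k) ↦ triVert v k`). -/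
def cornerSites (Λ : Finset HexVertex) : Finset (Site 2) :=
  (Λ ×ˢ (Finset.univ : Finset (Fin 3))).image fun vk => Dev.triVert vk.1 vk.2

/-- Corners of faces of `Λ` are corner sites. -/
theorem triVert_mem_cornerSites {Λ : Finset HexVertex} {v : HexVertex} (hv : v ∈ Λ) (k : Fin 3) :
    Dev.triVert v k ∈ cornerSites Λ :=
  Finset.mem_image.2 ⟨(v, k), Finset.mem_product.2 ⟨hv, Finset.mem_univ _⟩, rfl⟩

/-- A site is a corner site of `Λ` iff one of the six faces around it lies in `Λ`. -/
theorem mem_cornerSites_iff {Λ : Finset HexVertex} {s : Site 2} :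
    s ∈ cornerSites Λ ↔ ∃ j : Fin 6, HexKernel.face s j ∈ Λ := by
  constructor
  · intro h
    obtain ⟨⟨v, k⟩, hvk, rfl⟩ := Finset.mem_image.1 h
    exact ⟨cornerFaceIdx v k, by rw [face_triVert]; exact (Finset.mem_product.1 hvk).1⟩
  · rintro ⟨j, hj⟩
    rw [← triVert_face s j]
    exact triVert_mem_cornerSites hj _

/-- The site-by-site sum with indicators is a sum over the (site, face-number) pairs with the face
in `Λ`. -/
theorem sum_sites_ite_eq {M : Type*} [AddCommMonoid M] (Λ : Finset HexVertex)
    (g : Site 2 → Fin 6 → M) :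
    ∑ s ∈ cornerSites Λ, ∑ j : Fin 6, (if HexKernel.face s j ∈ Λ then g s j else 0) =
      ∑ y ∈ (cornerSites Λ ×ˢ (Finset.univ : Finset (Fin 6))).filter
          (fun y => HexKernel.face y.1 y.2 ∈ Λ), g y.1 y.2 := by
  rw [Finset.sum_filter, Finset.sum_product]

/-- **Regrouping corners by site (registered form).** The face-by-face sum of corner data over `Λ`
equals the site-by-site sum, over the corner sites, of the data at those of the six surrounding faces
that lie in `Λ`. -/
theorem st_sum_corners_by_site : ∀ {M : Type*} [AddCommMonoid M] (Λ : Finset HexVertex) (f : HexVertex → Fin 3 → M), ∑ v ∈ Λ, ∑ k : Fin 3, f v k = ∑ s ∈ cornerSites Λ, ∑ j : Fin 6, (if HexKernel.face s j ∈ Λ then f (HexKernel.face s j) (siteCornerIdx j) else 0) := by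
  intro M _ Λ f
  rw [sum_sites_ite_eq Λ fun s j => f (HexKernel.face s j) (siteCornerIdx j), ← Finset.sum_product']
  refine Finset.sum_nbij' (fun x => (Dev.triVert x.1 x.2, cornerFaceIdx x.1 x.2))
    (fun y => (HexKernel.face y.1 y.2, siteCornerIdx y.2)) ?_ ?_ ?_ ?_ ?_
  · rintro ⟨v, k⟩ hx
    have hv : v ∈ Λ := (Finset.mem_product.1 hx).1
    refine Finset.mem_filter.2 ⟨Finset.mem_product.2 ⟨triVert_mem_cornerSites hv k, Finset.mem_univ _⟩, ?_⟩
    show HexKernel.face (Dev.triVert v k) (cornerFaceIdx v k) ∈ Λ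
    rw [face_triVert]
    exact hv
  · rintro ⟨s, j⟩ hy
    exact Finset.mem_product.2 ⟨(Finset.mem_filter.1 hy).2, Finset.mem_univ _⟩
  · rintro ⟨v, k⟩ -
    simp only [face_triVert, siteCornerIdx_cornerFaceIdx]
  · rintro ⟨s, j⟩ -
    simp only [triVert_face, cornerFaceIdx_face]
  · rintro ⟨v, k⟩ -
    simp only [face_triVert, siteCornerIdx_cornerFaceIdx]

/-- **Interior versus boundary sites (registered form).** The site-by-site sum splits into the sites
all six of whose faces lie in `Λ` (full hexagons: no indicator left) and the remaining corner sites
(at least one face outside `Λ`). -/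
theorem st_sum_corners_split : ∀ {M : Type*} [AddCommMonoid M] (Λ : Finset HexVertex) (f : HexVertex → Fin 3 → M), ∑ v ∈ Λ, ∑ k : Fin 3, f v k = ∑ s ∈ (cornerSites Λ).filter (fun s => ∀ j : Fin 6, HexKernel.face s j ∈ Λ), ∑ j : Fin 6, f (HexKernel.face s j) (siteCornerIdx j) + ∑ s ∈ (cornerSites Λ).filter (fun s => ¬ ∀ j : Fin 6, HexKernel.face s j ∈ Λ), ∑ j : Fin 6, (if HexKernel.face s j ∈ Λ then f (HexKernel.face s j) (siteCornerIdx j) else 0) := by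
  intro M _ Λ f
  rw [st_sum_corners_by_site Λ f, ← Finset.sum_filter_add_sum_filter_not (cornerSites Λ)
    (fun s => ∀ j : Fin 6, HexKernel.face s j ∈ Λ)]
  congr 1
  refine Finset.sum_congr rfl fun s hs => Finset.sum_congr rfl fun j _ => ?_
  rw [if_pos ((Finset.mem_filter.1 hs).2 j)]

end Stokes

end Summit.CriticalPhenomena.SAWScalingLimit.Cruxes.QCIdentification.EightFifthsPrimitive
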